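import Literature.MathematicalPhysics.QuantumFieldTheory.Balaban1983to89.B9Thm31GpAgmonDecayCoarseZd

/-!
# `Balaban1983to89.B9Thm31GpAgmonL2LocalCoarseZd` — [Balaban1985BackgroundPropagators] Thm 3.1 (3.46) p. 398 («‖hG′(U)λ‖ ≦ B₀(Lʲη)(Lʲ′η)e^{−δ₀d(y,y′)}‖h‖‖λ‖») FOR THE
# GENUINE `G′(U₀)` AT THE `ℤᵈ` CARRIER — THE `L²`-LOCAL EDITION OF THE COARSE AGMON ROAD: with the distance-to-the-source weight `ρ = L^{−m}·dist_∞(·, B)` (zero on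
# `B ⊇ supp Ψ`, `≥ L^{−m}D` on a set `A` at `ℓ∞`-distance `≥ D` from `B`), under the DISPLAYED level-weighted coercivity and the two scaling inequalities of
# `B9Thm31GpAgmonDecayCoarseZd`, for every `0 ≤ κ ≤ min{1, θc₀∕(6dB + 15A)}`:
# ★★★ `Σ_{z∈Ω₀∩A}|(G′(U₀)Ψ)(z)|²_τ ≤ e^{−2κL^{−m}D}·‖Ψ‖²_τ ∕ (((1−θ)c₀)²·M_A·M_B)` — print's (3.46a) shape at the coarsest scale, NO `η`, NO `|Ω₀|`

statement-level skeleton of published theorems with citation tags; proofs where landed; nothing here is a claim about the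
Yang–Mills mass gap

`[Balaban1985BackgroundPropagators]` ("B9", CMP **99** (1985) 389–434) p. 398 *«Finally, we have the inequalities in L₂-norms ‖hG′(U)λ‖ … ≦ B₀(Lʲη)(Lʲ′η)e^{−δ₀d(y,y′)}‖h‖‖λ‖ for
supp h ⊂ Δ̃(y), y ∈ Λ_j, supp λ ⊂ Δ̃(y′) (3.46)»*; Thm 3.1 p. 397 (*«uniformly in U, Ω_j»*).  Print: random walk (Sect. B).  THIS FILE is the set-to-set companion of
`B9Thm31GpAgmonDecayCoarseZd.fnorm_GpZd_single_le_exp_coarse` (pointwise): FILE 3's second Agmon reading `sq_sum_GpZd_le_of_levelCoercive` with the exponential weight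
of the `ℓ∞`-distance to the source set `B` at the coarsest scale — the weight is `1` on `B`, `≥ e^{κL^{−m}D}` on `A`, its bond increments are `≤ L^{−m}` and its oscillation on
every block of level `j ≤ m` is `≤ 1`, so the window of FILE 4 (`window_of_scaling`) applies verbatim.  With level masses `M ≥ m₀(L^{j}η)⁻²` on `A`, `B` the right side is
print's `B₀²(L^{j_A}η)²(L^{j_B}η)²e^{−2δ₀d}‖λ‖²` with `B₀ = 1∕((1−θ)c₀m₀)`, `δ₀ = κL^{−m}` per fine site.

CITATION HEADER (lean-in-tree rule).  Cell `pub-ymgap` (YM Track A, HUMAN RULING D-0062 ∕ D-0149 width push), DAG node N06 = [B9], width seat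
`pub-ymgap-dag-n06-w2` (g5), CLAIM-8.  Inputs BY NAME: FILE 3's `sq_sum_GpZd_le_of_levelCoercive ∕ bondRatio_exp_le ∕ abs_exp_div_exp_sub_one_le ∕ two_eps_eq`, FILE 4's
`window_of_scaling ∕ abs_linfDist_sub_linfDist_step_le ∕ blockMapIter_eq_iterate`, g4's `linfDist_le_of_blockMap_iterate_eq`, Mathlib's `Finset.inf'` API.  Nothing restated.

WHAT IS PROVED (kernel, 0 sorry, 0 def; no `instance`, no `notation`).
* §1 the `ℓ∞`-distance to a nonempty finite set (`B.inf' hB (linfDist ·)`): `infDist_le_linfDist_add` (`dist(x,B) ≤ |x − x′|_∞ + dist(x′,B)`), `abs_infDist_sub_le`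
  (`|dist(x,B) − dist(x′,B)| ≤ |x − x′|_∞`), `infDist_eq_zero_of_mem`, `le_infDist_of_sep`.
* §2 ★★ `sq_sum_GpZd_le_exp_of_levelCoercive` — THE SET-TO-SET EXPONENTIAL READING (FILE 3's slots): `ρ` with bond increments `≤ ℓ`, level-`j` block radii `≤ σ_j`, `ρ = 0`
  on `B ⊇ supp Ψ`, `ρ ≥ R` on `A`, window `6dη⁻²(cosh κℓ − 1) + Σ_j𝟙a_j(e^{2κσ_j} − 1)(Lᵈ)^{−j} ≤ θc₀M` ⟹
  `Σ_{Ω₀∩A}|(G′Ψ)|²_τ ≤ ‖Ψ‖²_τ∕(((1−θ)c₀)²M_AM_B·e^{2κR})`.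
* §3 ★★★ `sq_sum_GpZd_le_exp_coarse` — THE COARSE-SCALE (3.46a) SHAPE: `ρ = L^{−m}dist_∞(·,B)`, `D ≤ |z − y|_∞` for `z ∈ A`, `y ∈ B`, the scaling slots `η⁻²L^{−2m} ≤ B·M`,
  `Σ_j𝟙a_j(Lᵈ)^{−j} ≤ A·M`, `0 ≤ κ ≤ 1`, `κ(6dB + 15A) ≤ θc₀` ⟹ `Σ_{Ω₀∩A}|(G′(U₀)Ψ)|²_τ ≤ ‖Ψ‖²_τ∕(((1−θ)c₀)²M_AM_B·e^{2κL^{−m}D})`.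

HONEST SCOPE.  A REDUCTION with explicit constants (displayed `hco` and scaling slots; discharged at cube members by FILES 5–7 of this seat); single coarsest-scale rate; `L²_τ`
currency; NOT print's multi-scale `d(y,y′)`, NOT the derivative companions of (3.46), NOT (3.47).  Count-neutral; N05 ∕ N06 NOT discharged; K1⁹ `stmt-QuantumFields-27364` NOT
closed; one finite `𝕋⁴` programme at fixed `ε`, Bałaban as printed; R4 closes only the conditional finite-`𝕋⁴` rung `BalabanLadder.UV` — nothing continuum ∕ ℝ⁴ ∕ OS ∕ mass
gap ∕ Clay.  Unit `pub-ymgap-dag-n06-w2` (g5), 2026-08-28.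
-/

noncomputable section

open scoped BigOperators

namespace Literature.MathematicalPhysics.QuantumFieldTheory.Balaban1983to89.B9Thm31GpAgmonL2LocalCoarseZd

open Literature.MathematicalPhysics.QuantumLattice (blockMap)
open B7Prop1Explicit (e)
open B7Prop2Explicit (unitaryUnits)
open B8Eq119TwistedAxial (bgT)
open B9Eq321LandauProjectionZd (suppSub formE formE_apply)
open B9Eq324DeltaPrimeAZd (single restrictSite deltaPrimeADom GpZd)
open B9Eq325QprimeSingleSiteZd (blockMapIter)
open B9Eq342CombesThomasFormZd
open B9Thm31GpDecayOfCoerciveZd (linfDist_le_of_blockMap_iterate_eq)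
open B9Eq323ConjugatedLaplacianFormZd (bondRatio)
open B9Thm31GpAgmonDecayZd (sq_sum_GpZd_le_of_levelCoercive bondRatio_exp_le abs_exp_div_exp_sub_one_le two_eps_eq)
open B9Thm31GpAgmonDecayCoarseZd (window_of_scaling abs_linfDist_sub_linfDist_step_le blockMapIter_eq_iterate)
open LatticeNorms (linfDist)

export B7Prop1Explicit (Site)

variable {d : ℕ} {𝔸 : Type*} [CStarAlgebra 𝔸]

/-! ## §1  The `ℓ∞`-distance to a nonempty finite set -/

section InfDist

omit [CStarAlgebra 𝔸] in
/-- `dist(x,B) ≤ |x − x′|_∞ + dist(x′,B)`. [folklore] [cite: Balaban1985BackgroundPropagators, (3.46) p.398 (the distance `d(y,y′)`; bookkeeping)] -/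
theorem infDist_le_linfDist_add {B : Finset (Site d)} (hB : B.Nonempty) (x x' : Site d) :
    ((B.inf' hB (fun y => linfDist x y) : ℕ) : ℝ) ≤ ((linfDist x x' : ℕ) : ℝ) + ((B.inf' hB (fun y => linfDist x' y) : ℕ) : ℝ) := by
  obtain ⟨y₁, hy₁, heq⟩ := Finset.exists_mem_eq_inf' hB (fun y => linfDist x' y)
  rw [heq]
  have h1 : B.inf' hB (fun y => linfDist x y) ≤ linfDist x y₁ := Finset.inf'_le _ hy₁
  have h2 : linfDist x y₁ ≤ linfDist x x' + linfDist x' y₁ := LatticeNorms.linfDist_triangle x x' y₁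
  exact_mod_cast h1.trans h2

omit [CStarAlgebra 𝔸] in
/-- `|dist(x,B) − dist(x′,B)| ≤ |x − x′|_∞`. [folklore] [cite: Balaban1985BackgroundPropagators, (3.46) p.398 (bookkeeping)] -/
theorem abs_infDist_sub_le {B : Finset (Site d)} (hB : B.Nonempty) (x x' : Site d) :
    |((B.inf' hB (fun y => linfDist x y) : ℕ) : ℝ) - ((B.inf' hB (fun y => linfDist x' y) : ℕ) : ℝ)| ≤ ((linfDist x x' : ℕ) : ℝ) := by
  rw [abs_sub_le_iff]
  constructor
  · have := infDist_le_linfDist_add (d := d) hB x x'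
    linarith
  · have := infDist_le_linfDist_add (d := d) hB x' x
    rw [LatticeNorms.linfDist_comm] at this
    linarith

omit [CStarAlgebra 𝔸] in
/-- `dist(y,B) = 0` for `y ∈ B`. [folklore] [cite: Balaban1985BackgroundPropagators, (3.46) p.398 (bookkeeping)] -/
theorem infDist_eq_zero_of_mem {B : Finset (Site d)} (hB : B.Nonempty) {y : Site d} (hy : y ∈ B) :
    ((B.inf' hB (fun y' => linfDist y y') : ℕ) : ℝ) = 0 := by
  have h : B.inf' hB (fun y' => linfDist y y') ≤ linfDist y y := Finset.inf'_le _ hy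
  rw [LatticeNorms.linfDist_self] at h
  exact_mod_cast Nat.le_zero.1 h

omit [CStarAlgebra 𝔸] in
/-- a set `A` at `ℓ∞`-distance `≥ D` from `B` has `dist(z,B) ≥ D` on `A`. [folklore] [cite: Balaban1985BackgroundPropagators, (3.46) p.398 (bookkeeping)] -/
theorem le_infDist_of_sep {B : Finset (Site d)} (hB : B.Nonempty) {D : ℕ} {z : Site d} (hsep : ∀ y ∈ B, D ≤ linfDist z y) :
    (D : ℝ) ≤ ((B.inf' hB (fun y => linfDist z y) : ℕ) : ℝ) := by
  exact_mod_cast (Finset.le_inf'_iff hB _).2 hsep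

end InfDist

/-! ## §2  The set-to-set exponential reading -/

section SetExp

variable (L : ℕ) (U₀ : Site d → Fin d → 𝔸ˣ) (η : ℝ) (τ : 𝔸 →ₗ[ℂ] ℂ) [FiniteDimensional ℝ 𝔸]
  (hτp : ∀ a : 𝔸, a ≠ 0 → 0 < (τ (star a * a)).re) (m : ℕ) (a : ℕ → ℝ) (Λ : ℕ → Finset (Site d)) (s : Finset (Site d))

/-- ★★ **THE SET-TO-SET EXPONENTIAL READING.**  Data as in `B9Thm31GpAgmonDecayZd.sq_sum_GpZd_le_of_levelCoercive` with `ω = e^{κρ}`: `ρ` of bond increments `≤ ℓ`, level-`j`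
block radii `≤ σ_j` (`σ ≥ 0`) about references, `ρ = 0` on `B ⊇ supp Ψ`, `R ≤ ρ` on `A`, masses `≥ M_A` on `A`, `≥ M_B` on `B`, WINDOW
`∀ z ∈ Ω₀, 6dη⁻²(cosh κℓ − 1) + Σ_{j≤m}𝟙[yʲ(z)∈Λ_j]a_j(e^{2κσ_j} − 1)(Lᵈ)^{−j} ≤ θc₀M(z)` ⟹ `Σ_{z∈Ω₀∩A}|(G′(U₀)Ψ)(z)|²_τ ≤ ‖Ψ‖²_τ∕(((1−θ)c₀)²·M_A·M_B·(e^{κR})²)`.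
[cite: Balaban1985BackgroundPropagators, Thm 3.1 p.397, (3.46) p.398, (3.24) p.394; Agmon1982, Thm 1.5 p.19] -/
theorem sq_sum_GpZd_le_exp_of_levelCoercive [NeZero L] (hd : 0 < d) (hη : η ≠ 0) (hτt : ∀ a b : 𝔸, τ (a * b) = τ (b * a))
    (hτs : ∀ a : 𝔸, τ (star a) = starRingEnd ℂ (τ a)) (hU : ∀ (x : Site d) (κ : Fin d), U₀ x κ ∈ unitaryUnits 𝔸)
    (hT : ∀ j', j' < m → ∀ z y : Site d, bgT L U₀ j' z y ∈ unitaryUnits 𝔸) (ha : ∀ j, 0 ≤ a j)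
    {c₀ θ : ℝ} (hc₀ : 0 < c₀) (hθ0 : 0 ≤ θ) (hθ1 : θ < 1) {M : Site d → ℝ} (hM0 : ∀ z ∈ s, 0 ≤ M z)
    (hco : ∀ Φ : suppSub (𝔸 := 𝔸) s, c₀ * ∑ z ∈ s, M z * fnorm τ ((Φ : Site d → 𝔸) z) ^ 2 ≤ formE τ s Φ (deltaPrimeADom L U₀ η τ hτp m a Λ s Φ))
    {κ ℓ R : ℝ} (hκ : 0 ≤ κ) {σ : ℕ → ℝ} (hσ : ∀ j, 0 ≤ σ j) {ρ : Site d → ℝ} {rref : ℕ → Site d → ℝ}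
    (hlip : ∀ (z : Site d) (μ : Fin d), |ρ (z + e μ) - ρ z| ≤ ℓ)
    (hblk : ∀ j ∈ Finset.range (m + 1), ∀ y ∈ Λ j, ∀ x ∈ s, blockMapIter L j x = y → |ρ x - rref j y| ≤ σ j)
    (hwin : ∀ z ∈ s, 6 * d * (η⁻¹) ^ 2 * (Real.cosh (κ * ℓ) - 1) +
      ∑ j ∈ Finset.range (m + 1), (if blockMapIter L j z ∈ Λ j then a j * (Real.exp (2 * κ * σ j) - 1) * (((L : ℝ) ^ d)⁻¹) ^ j else 0) ≤ θ * c₀ * M z)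
    {mA mB : ℝ} (hmA : 0 < mA) (hmB : 0 < mB) {A B : Finset (Site d)}
    (hmA' : ∀ z ∈ A, mA ≤ M z) (hmB' : ∀ z ∈ B, mB ≤ M z) (hρA : ∀ z ∈ A, R ≤ ρ z) (hρB : ∀ z ∈ B, ρ z = 0)
    {Ψ : suppSub (𝔸 := 𝔸) s} (hΨB : ∀ z, z ∉ B → (Ψ : Site d → 𝔸) z = 0) :
    ∑ z ∈ s ∩ A, fnorm τ ((GpZd L U₀ η τ hτp m a Λ s hd hη hτt hτs hU ha Ψ : Site d → 𝔸) z) ^ 2 ≤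
      formE τ s Ψ Ψ / (((1 - θ) * c₀) ^ 2 * mA * mB * Real.exp (κ * R) ^ 2) := by
  -- the weight, references and oscillation constants (as in FILE 3's pointwise edition)
  set ω : Site d → ℝ := fun z => Real.exp (κ * ρ z) with hω
  have hωpos : ∀ z, 0 < ω z := fun z => Real.exp_pos _
  set wref : ℕ → Site d → ℝ := fun j y' => Real.exp (κ * rref j y') with hwref
  have hwrefpos : ∀ j y', 0 < wref j y' := fun j y' => Real.exp_pos _
  set δ : ℕ → ℝ := fun j => Real.exp (κ * σ j) - 1 with hδ
  have hδ0 : ∀ j, 0 ≤ δ j := fun j => by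
    have h1 := Real.add_one_le_exp (κ * σ j)
    have h2 : 0 ≤ κ * σ j := mul_nonneg hκ (hσ j)
    show 0 ≤ Real.exp (κ * σ j) - 1
    linarith
  have hosc : ∀ j ∈ Finset.range (m + 1), ∀ y' ∈ Λ j, ∀ x' ∈ s, blockMapIter L j x' = y' →
      |ω x' / wref j y' - 1| ≤ δ j ∧ |wref j y' / ω x' - 1| ≤ δ j := by
    intro j hj y' hy' x' hx' hxy
    have hb := hblk j hj y' hy' x' hx' hxy
    constructor
    · exact abs_exp_div_exp_sub_one_le hκ hb
    · refine abs_exp_div_exp_sub_one_le hκ ?_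
      rw [abs_sub_comm]; exact hb
  have hJ : ∀ z ∈ s, ((η⁻¹) ^ 2 * ∑ μ : Fin d, (5 / 2 * bondRatio ω (z - e μ) μ + 1 / 2 * bondRatio ω z μ)) +
      ∑ j ∈ Finset.range (m + 1),
        (if blockMapIter L j z ∈ Λ j then a j * (δ j + δ j + δ j * δ j) * (((L : ℝ) ^ d)⁻¹) ^ j else 0) ≤ θ * c₀ * M z := by
    intro z hz
    refine le_trans (add_le_add ?_ (le_of_eq ?_)) (hwin z hz)
    · have hr : ∀ (z : Site d) (μ : Fin d), bondRatio ω z μ ≤ 2 * (Real.cosh (κ * ℓ) - 1) := fun z μ => bondRatio_exp_le hκ (hlip z μ)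
      have hsum : ∑ μ : Fin d, (5 / 2 * bondRatio ω (z - e μ) μ + 1 / 2 * bondRatio ω z μ) ≤ ∑ _μ : Fin d, 6 * (Real.cosh (κ * ℓ) - 1) := by
        refine Finset.sum_le_sum fun μ _ => ?_
        have h1 := hr (z - e μ) μ
        have h2 := hr z μ
        linarith
      rw [Finset.sum_const, Finset.card_univ, Fintype.card_fin, nsmul_eq_mul] at hsum
      calc (η⁻¹) ^ 2 * ∑ μ : Fin d, (5 / 2 * bondRatio ω (z - e μ) μ + 1 / 2 * bondRatio ω z μ)
          ≤ (η⁻¹) ^ 2 * ((d : ℝ) * (6 * (Real.cosh (κ * ℓ) - 1))) := mul_le_mul_of_nonneg_left hsum (sq_nonneg _)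
        _ = 6 * d * (η⁻¹) ^ 2 * (Real.cosh (κ * ℓ) - 1) := by ring
    · refine Finset.sum_congr rfl fun j _ => ?_
      by_cases hzj : blockMapIter L j z ∈ Λ j
      · simp only [hzj, if_true, hδ, two_eps_eq]
      · simp only [hzj, if_false]
  have hW : 0 < Real.exp (κ * R) := Real.exp_pos _
  have hWA : ∀ z ∈ A, Real.exp (κ * R) ≤ ω z := fun z hz =>
    Real.exp_le_exp.2 (mul_le_mul_of_nonneg_left (hρA z hz) hκ)
  have hωB : ∀ z ∈ B, ω z = 1 := fun z hz => by simp [hω, hρB z hz]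
  exact sq_sum_GpZd_le_of_levelCoercive L U₀ η τ hτp m a Λ s hd hη hτt hτs hU hT ha hc₀ hθ0 hθ1 hM0 hco hωpos hwrefpos hδ0 hδ0 hosc hJ
    hmA hmB hW hmA' hmB' hWA hωB hΨB

end SetExp

/-! ## §3  ★★★ The coarse-scale (3.46a) shape: the weight of the distance to the source set -/

section Coarse

variable (L : ℕ) (U₀ : Site d → Fin d → 𝔸ˣ) (η : ℝ) (τ : 𝔸 →ₗ[ℂ] ℂ) [FiniteDimensional ℝ 𝔸]
  (hτp : ∀ a : 𝔸, a ≠ 0 → 0 < (τ (star a * a)).re) (m : ℕ) (a : ℕ → ℝ) (Λ : ℕ → Finset (Site d)) (s : Finset (Site d))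

/-- ★★★ **[B9] THM 3.1's (3.46a) SHAPE FOR THE GENUINE `G′(U₀)`, COARSE SCALE, EXPLICIT UNIFORM CONSTANTS.**  `L ≥ 1`; `U₀` unitary with unitary averaged transporters
below `m`; `a ≥ 0`; `0 < d`, `η ≠ 0`; tracial Hermitian faithful `τ`; DISPLAYED level-weighted coercivity (`c₀ > 0`, `M ≥ 0`) and the SCALING slots `η⁻²(Lᵐ)⁻² ≤ B·M(z)`,
`Σ_{j≤m}𝟙[yʲ(z)∈Λ_j]a_j(Lᵈ)^{−j} ≤ A·M(z)` on `Ω₀`; `0 ≤ θ < 1`; `0 ≤ κ ≤ 1` with `κ(6dB + 15A) ≤ θc₀`.  For finite site sets `A`, `B` (`B` nonempty) at `ℓ∞`-distance `≥ D`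
(`D ≤ |z − y|_∞` for `z ∈ A`, `y ∈ B`), masses `≥ M_A > 0` on `A`, `≥ M_B > 0` on `B`, and `Ψ ∈ L²(Ω₀, ·)` vanishing off `B`:
`Σ_{z∈Ω₀∩A}|(G′(U₀)Ψ)(z)|²_τ ≤ ‖Ψ‖²_τ ∕ (((1−θ)c₀)²·M_A·M_B·(e^{κL^{−m}D})²)`.
[cite: Balaban1985BackgroundPropagators, Thm 3.1 p.397, (3.46) p.398, (3.42) p.397, (3.24) p.394, Thm 3.11 p.416; Agmon1982, Thm 1.5 p.19] -/
theorem sq_sum_GpZd_le_exp_coarse [NeZero L] (hd : 0 < d) (hη : η ≠ 0) (hL : 1 ≤ L) (hτt : ∀ a b : 𝔸, τ (a * b) = τ (b * a))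
    (hτs : ∀ a : 𝔸, τ (star a) = starRingEnd ℂ (τ a)) (hU : ∀ (x : Site d) (κ : Fin d), U₀ x κ ∈ unitaryUnits 𝔸)
    (hT : ∀ j', j' < m → ∀ z y : Site d, bgT L U₀ j' z y ∈ unitaryUnits 𝔸) (ha : ∀ j, 0 ≤ a j)
    {c₀ θ : ℝ} (hc₀ : 0 < c₀) (hθ0 : 0 ≤ θ) (hθ1 : θ < 1) {M : Site d → ℝ} (hM0 : ∀ z ∈ s, 0 ≤ M z)
    (hco : ∀ Φ : suppSub (𝔸 := 𝔸) s, c₀ * ∑ z ∈ s, M z * fnorm τ ((Φ : Site d → 𝔸) z) ^ 2 ≤ formE τ s Φ (deltaPrimeADom L U₀ η τ hτp m a Λ s Φ))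
    {A' B' κ : ℝ} (hκ0 : 0 ≤ κ) (hκ1 : κ ≤ 1) (hκ : κ * (6 * d * B' + 15 * A') ≤ θ * c₀)
    (hB : ∀ z ∈ s, (η⁻¹) ^ 2 * (((L : ℝ) ^ m)⁻¹) ^ 2 ≤ B' * M z)
    (hA : ∀ z ∈ s, ∑ j ∈ Finset.range (m + 1), (if blockMapIter L j z ∈ Λ j then a j * (((L : ℝ) ^ d)⁻¹) ^ j else 0) ≤ A' * M z)
    {mA mB : ℝ} (hmA : 0 < mA) (hmB : 0 < mB) {A B : Finset (Site d)} (hBne : B.Nonempty) {D : ℕ}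
    (hsep : ∀ z ∈ A, ∀ y ∈ B, D ≤ linfDist z y)
    (hmA' : ∀ z ∈ A, mA ≤ M z) (hmB' : ∀ z ∈ B, mB ≤ M z)
    {Ψ : suppSub (𝔸 := 𝔸) s} (hΨB : ∀ z, z ∉ B → (Ψ : Site d → 𝔸) z = 0) :
    ∑ z ∈ s ∩ A, fnorm τ ((GpZd L U₀ η τ hτp m a Λ s hd hη hτt hτs hU ha Ψ : Site d → 𝔸) z) ^ 2 ≤
      formE τ s Ψ Ψ / (((1 - θ) * c₀) ^ 2 * mA * mB * Real.exp (κ * (((L : ℝ) ^ m)⁻¹ * (D : ℝ))) ^ 2) := by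
  classical
  have hL0 : (0 : ℝ) < L := by exact_mod_cast hL
  have hLm : 0 < ((L : ℝ) ^ m)⁻¹ := by positivity
  -- the weight data: `ρ = L^{−m} dist(·, B)`
  set dB : Site d → ℝ := fun z => ((B.inf' hBne (fun y => linfDist z y) : ℕ) : ℝ) with hdB
  set ρ : Site d → ℝ := fun z => ((L : ℝ) ^ m)⁻¹ * dB z with hρ
  set rref : ℕ → Site d → ℝ := fun j y' => if h : ∃ x₀ ∈ s, blockMapIter L j x₀ = y' then ρ (Classical.choose h) else 0 with hrref
  have hlip : ∀ (z : Site d) (μ : Fin d), |ρ (z + e μ) - ρ z| ≤ ((L : ℝ) ^ m)⁻¹ := by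
    intro z μ
    show |((L : ℝ) ^ m)⁻¹ * dB (z + e μ) - ((L : ℝ) ^ m)⁻¹ * dB z| ≤ ((L : ℝ) ^ m)⁻¹
    rw [← mul_sub, abs_mul, abs_of_pos hLm]
    have h := abs_infDist_sub_le (d := d) hBne (z + e μ) z
    have hstep : ((linfDist (z + e μ) z : ℕ) : ℝ) ≤ 1 := by
      have h' := abs_linfDist_sub_linfDist_step_le (d := d) z z μ
      rw [LatticeNorms.linfDist_self, Nat.cast_zero, sub_zero] at h'
      exact (le_abs_self _).trans h'
    calc ((L : ℝ) ^ m)⁻¹ * |dB (z + e μ) - dB z| ≤ ((L : ℝ) ^ m)⁻¹ * 1 := mul_le_mul_of_nonneg_left (h.trans hstep) hLm.le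
      _ = ((L : ℝ) ^ m)⁻¹ := mul_one _
  have hblk : ∀ j ∈ Finset.range (m + 1), ∀ y' ∈ Λ j, ∀ x' ∈ s, blockMapIter L j x' = y' → |ρ x' - rref j y'| ≤ (fun _ : ℕ => (1 : ℝ)) j := by
    intro j hj y' _ x' hx' hxy
    have hex : ∃ x₀ ∈ s, blockMapIter L j x₀ = y' := ⟨x', hx', hxy⟩
    have hr : rref j y' = ρ (Classical.choose hex) := by simp only [hrref, dif_pos hex]
    rw [hr]
    set x₀ := Classical.choose hex with hx₀
    have hspec := Classical.choose_spec hex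
    show |((L : ℝ) ^ m)⁻¹ * dB x' - ((L : ℝ) ^ m)⁻¹ * dB x₀| ≤ 1
    rw [← mul_sub, abs_mul, abs_of_pos hLm]
    -- `|x′ − x₀|_∞ + 1 ≤ Lʲ ≤ Lᵐ`
    have hsame : (blockMap L)^[j] x' = (blockMap L)^[j] x₀ := by
      rw [← blockMapIter_eq_iterate, ← blockMapIter_eq_iterate, hxy, hspec.2]
    have hblock := linfDist_le_of_blockMap_iterate_eq (d := d) hL j hsame
    have hjm : j ≤ m := by have := Finset.mem_range.1 hj; omega
    have hpow : L ^ j ≤ L ^ m := Nat.pow_le_pow_right hL hjm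
    have hdist : ((linfDist x' x₀ : ℕ) : ℝ) + 1 ≤ (L : ℝ) ^ m := by exact_mod_cast hblock.trans hpow
    have hle : |dB x' - dB x₀| ≤ (L : ℝ) ^ m := (abs_infDist_sub_le (d := d) hBne x' x₀).trans (by linarith)
    calc ((L : ℝ) ^ m)⁻¹ * |dB x' - dB x₀| ≤ ((L : ℝ) ^ m)⁻¹ * (L : ℝ) ^ m := mul_le_mul_of_nonneg_left hle hLm.le
      _ = 1 := inv_mul_cancel₀ (by positivity)
  have hwin : ∀ z ∈ s, 6 * d * (η⁻¹) ^ 2 * (Real.cosh (κ * ((L : ℝ) ^ m)⁻¹) - 1) +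
      ∑ j ∈ Finset.range (m + 1), (if blockMapIter L j z ∈ Λ j then a j * (Real.exp (2 * κ * (fun _ : ℕ => (1 : ℝ)) j) - 1) * (((L : ℝ) ^ d)⁻¹) ^ j else 0)
        ≤ θ * c₀ * M z := fun z hz => window_of_scaling (d := d) hL ha Λ hM0 hκ0 hκ1 hκ hB hA hz
  have hρA : ∀ z ∈ A, ((L : ℝ) ^ m)⁻¹ * (D : ℝ) ≤ ρ z := fun z hz =>
    mul_le_mul_of_nonneg_left (le_infDist_of_sep (d := d) hBne (hsep z hz)) hLm.le
  have hρB : ∀ z ∈ B, ρ z = 0 := fun z hz => by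
    show ((L : ℝ) ^ m)⁻¹ * dB z = 0
    rw [hdB]; simp only [infDist_eq_zero_of_mem (d := d) hBne hz, mul_zero]
  exact sq_sum_GpZd_le_exp_of_levelCoercive L U₀ η τ hτp m a Λ s hd hη hτt hτs hU hT ha hc₀ hθ0 hθ1 hM0 hco hκ0 (σ := fun _ => (1 : ℝ))
    (fun _ => zero_le_one) hlip hblk hwin hmA hmB hmA' hmB' hρA hρB hΨB

end Coarse

end Literature.MathematicalPhysics.QuantumFieldTheory.Balaban1983to89.B9Thm31GpAgmonL2LocalCoarseZd

end
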